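import Mathlib

/-!
# The exterior algebra of a finite free module: commuting 2-forms, the top-degree integral and the form
`(x, y) ↦ ∫ x ∧ y ∧ Λ`

Blind re-derivation cell `pub-hodge-repro`, seat `night-3` (gen 5).  Mathlib only.  Namespace `HodgeRepro.Night3.ExtTop`.

The generic layer of night-3's row «the concrete form `Q = ∫ x ∧ y ∧ Λ`» (NIGHT3.md §11): for a module `M` over a
commutative ring `R` with a basis `b : Basis I R M`, `I` finite and linearly ordered,

* `two_form_comm`: a 2-form `ι x * ι y` commutes with every element of `⋀^• M`; for index maps `f g : κ → I` and
  `e : I → M` the 2-forms `ω p = ι (e (f p)) * ι (e (g p))` pairwise commute and square to zero, so the subalgebra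
  `evenAdjoin R e f g` they generate is COMMUTATIVE (`IsMulCommutative`; with `open scoped IsMulCommutative` a
  `CommRing`) — sums, products over finsets and powers of the `ω'` are the usual ones there;
* `coe_prod_ω'`: a product `∏_{p ∈ T} ω' p` is a single wedge `ιMulti (2|T|) (e ∘ idx)` of the `2|T|` vectors
  `e (f p), e (g p)`, `p ∈ T`, along an injective enumeration `idx` (when those indices are pairwise distinct);
* `univPC`, the top form `ιMultiDual R N b univ` (Mathlib; `N = |I|`) and `ιMultiDual_univ_ιMulti_of_bijective`: the
  top form of the wedge of the basis vectors along ANY bijective enumeration `idx : Fin N ≃ I` is a sign `±1`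
  (`AlternatingMap.map_perm`), hence non-zero in characteristic zero;
* `wedgeForm b n k Λ hΛ hN : BilinForm R (⋀^n M)`, `(x, y) ↦ ιMultiDual (x * y * Λ)` for `Λ ∈ ⋀^k M`,
  `|I| = n + n + k` — the graded product `⋀^n · ⋀^n · ⋀^k ⊆ ⋀^{n+n+k}` is `Submodule.mul_mem_mul` since
  `⋀^j M = (range ι)^j`.

Nothing here is about Hodge theory; nothing here says anything about the status of the Hodge conjecture for CM
abelian varieties, which is NOT proved.
-/

set_option autoImplicit false

open Module Finset Function
open scoped IsMulCommutative

namespace HodgeRepro.Night3.ExtTop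

open ExteriorAlgebra

/-! ### Commuting 2-forms and the commutative subalgebra they generate -/

section Comm

variable {R : Type*} [CommRing R] {M : Type*} [AddCommGroup M] [Module R M]

/-- `ι x ι y = −ι y ι x`. -/
theorem ι_mul_ι_eq_neg (x y : M) : ι R x * ι R y = -(ι R y * ι R x) :=
  eq_neg_of_add_eq_zero_left (ι_add_mul_swap x y)

/-- **A 2-form commutes with every element of the exterior algebra** (two anticommutations per generator). -/
theorem two_form_comm (x y : M) (z : ExteriorAlgebra R M) :
    ι R x * ι R y * z = z * (ι R x * ι R y) := by
  induction z using ExteriorAlgebra.induction with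
  | algebraMap r => rw [Algebra.commutes]
  | ι w =>
    rw [mul_assoc, ι_mul_ι_eq_neg y w, mul_neg, ← mul_assoc, ι_mul_ι_eq_neg x w, neg_mul, neg_neg, mul_assoc]
  | mul a b ha hb => rw [← mul_assoc, ha, mul_assoc, hb, ← mul_assoc]
  | add a b ha hb => rw [mul_add, add_mul, ha, hb]

variable (R) {I κ : Type*} (e : I → M) (f g : κ → I)

/-- The 2-form `ω p = ι (e (f p)) * ι (e (g p))` (in the model: `e_{(i,ρ)} ∧ e_{(i,cρ)}`). -/
noncomputable def ω (p : κ) : ExteriorAlgebra R M := ι R (e (f p)) * ι R (e (g p))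

/-- `ω p` is the wedge of the two vectors `e (f p)`, `e (g p)`. -/
theorem ω_eq_ιMulti (p : κ) : ω R e f g p = ιMulti R 2 ![e (f p), e (g p)] := by
  simp [ω, ιMulti_apply]

/-- The 2-forms pairwise commute. -/
theorem ω_comm (p q : κ) : ω R e f g p * ω R e f g q = ω R e f g q * ω R e f g p := two_form_comm _ _ _

/-- The 2-forms square to zero. -/
theorem ω_sq (p : κ) : ω R e f g p ^ 2 = 0 := by
  rw [pow_two, ω, mul_assoc, ← mul_assoc (ι R (e (g p))), ι_mul_ι_eq_neg (e (g p)) (e (f p)), neg_mul,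
    mul_neg, ← mul_assoc, ← mul_assoc, ι_sq_zero, zero_mul, zero_mul, neg_zero]

/-- `ω p * (v₁ ∧ ⋯ ∧ v_k) = e (f p) ∧ e (g p) ∧ v₁ ∧ ⋯ ∧ v_k`. -/
theorem ω_mul_ιMulti (p : κ) {k : ℕ} (w : Fin k → M) :
    ω R e f g p * ιMulti R k w = ιMulti R (2 + k) (Fin.append ![e (f p), e (g p)] w) := by
  rw [ω_eq_ιMulti, ιMulti_mul_ιMulti]

/-- The subalgebra of `⋀^• M` generated by the 2-forms `ω p` — commutative. -/
noncomputable abbrev evenAdjoin : Subalgebra R (ExteriorAlgebra R M) :=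
  Algebra.adjoin R (Set.range (ω R e f g))

/-- The subalgebra generated by the 2-forms is commutative. -/
instance isMulCommutative_evenAdjoin : IsMulCommutative (evenAdjoin R e f g) :=
  Algebra.isMulCommutative_adjoin R (by
    rintro _ ⟨p, rfl⟩ _ ⟨q, rfl⟩
    exact ω_comm R e f g p q)

/-- `ω p` as an element of the commutative subalgebra. -/
noncomputable def ω' (p : κ) : evenAdjoin R e f g := ⟨ω R e f g p, Algebra.subset_adjoin ⟨p, rfl⟩⟩

/-- The underlying element of `ω' p` is `ω p`. -/
@[simp] theorem coe_ω' (p : κ) : (ω' R e f g p : ExteriorAlgebra R M) = ω R e f g p := rfl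

/-- `ω' p` squares to zero in the subalgebra. -/
theorem ω'_sq (p : κ) : ω' R e f g p ^ 2 = 0 := by
  apply Subtype.ext
  rw [Subalgebra.coe_pow, coe_ω', ω_sq, Subalgebra.coe_zero]

/-- `e ∘ (a ++ b) = (e ∘ a) ++ (e ∘ b)` for `Fin.append`. -/
theorem comp_append {α β : Type*} {m n : ℕ} (φ : α → β) (a : Fin m → α) (b : Fin n → α) :
    φ ∘ Fin.append a b = Fin.append (φ ∘ a) (φ ∘ b) := by
  funext i
  cases i using Fin.addCases with
  | left i => simp [Fin.append_left]
  | right i => simp [Fin.append_right]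

/-- `e ∘ ![a, b] = ![e a, e b]`. -/
theorem comp_vec2 {α β : Type*} (φ : α → β) (a b : α) : φ ∘ ![a, b] = ![φ a, φ b] := by
  funext i
  fin_cases i <;> rfl

/-- A two-element family with distinct entries is injective. -/
theorem vec2_injective {α : Type*} {a b : α} (h : a ≠ b) : Injective ![a, b] := by
  intro i j hij
  fin_cases i <;> fin_cases j
  · rfl
  · exact absurd hij h
  · exact absurd hij.symm h
  · rfl

/-- **A product of 2-forms is a single wedge**: for `T : Finset κ` whose `2|T|` indices `f p, g p` (`p ∈ T`) are
pairwise distinct, `∏_{p ∈ T} ω' p = ιMulti (2|T|) (e ∘ idx)` for an injective enumeration `idx` of those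
indices. -/
theorem coe_prod_ω' (T : Finset κ) (hf : Set.InjOn f T) (hg : Set.InjOn g T)
    (hfg : ∀ p ∈ T, ∀ q ∈ T, f p ≠ g q) :
    ∃ (k : ℕ) (idx : Fin k → I), k = 2 * T.card ∧ Injective idx ∧
      (∀ j, ∃ p ∈ T, idx j = f p ∨ idx j = g p) ∧
      ((∏ p ∈ T, ω' R e f g p : evenAdjoin R e f g) : ExteriorAlgebra R M) = ιMulti R k (e ∘ idx) := by
  classical
  induction T using Finset.induction_on with
  | empty =>
    refine ⟨0, Fin.elim0, by simp, fun i => i.elim0, fun j => j.elim0, ?_⟩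
    rw [prod_empty, Subalgebra.coe_one, ιMulti_zero_apply]
  | insert p T hp ih =>
    obtain ⟨k, idx, hk, hinj, hrange, hprod⟩ := ih (hf.mono (coe_subset.mpr (subset_insert p T)))
      (hg.mono (coe_subset.mpr (subset_insert p T)))
      (fun p' hp' q hq => hfg p' (mem_insert_of_mem hp') q (mem_insert_of_mem hq))
    refine ⟨2 + k, Fin.append ![f p, g p] idx, by rw [hk, card_insert_of_notMem hp]; ring, ?_, ?_, ?_⟩
    · refine Fin.append_injective_iff.mpr ⟨vec2_injective (hfg p (mem_insert_self p T) p (mem_insert_self p T)),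
        hinj, fun i j => ?_⟩
      obtain ⟨q, hq, hqj | hqj⟩ := hrange j <;> rw [hqj] <;> fin_cases i
      · intro h
        exact hp ((hf (mem_insert_self p T) (mem_insert_of_mem hq) h) ▸ hq)
      · exact fun h => hfg q (mem_insert_of_mem hq) p (mem_insert_self p T) h.symm
      · exact hfg p (mem_insert_self p T) q (mem_insert_of_mem hq)
      · intro h
        exact hp ((hg (mem_insert_self p T) (mem_insert_of_mem hq) h) ▸ hq)
    · intro j
      cases j using Fin.addCases with
      | left i =>
        fin_cases i
        · exact ⟨p, mem_insert_self p T, Or.inl (by simp [Fin.append_left])⟩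
        · exact ⟨p, mem_insert_self p T, Or.inr (by simp [Fin.append_left])⟩
      | right j =>
        obtain ⟨q, hq, hqj⟩ := hrange j
        exact ⟨q, mem_insert_of_mem hq, by simpa [Fin.append_right] using hqj⟩
    · rw [prod_insert hp, Subalgebra.coe_mul, coe_ω', hprod, ω_mul_ιMulti, comp_append, comp_vec2]

end Comm

/-! ### The top-degree integral and the form `(x, y) ↦ ∫ x ∧ y ∧ Λ` -/

section Top

variable {R : Type*} [CommRing R] {M : Type*} [AddCommGroup M] [Module R M]
variable {I : Type*} [LinearOrder I] [Fintype I]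

/-- `univ` as an `N`-element subset of `I`, `N = |I|`. -/
def univPC {N : ℕ} (hN : Fintype.card I = N) : Set.powersetCard I N :=
  ⟨univ, by rw [Set.powersetCard.mem_iff, card_univ, hN]⟩

/-- The increasing enumeration of `univ` is a bijection `Fin N → I`. -/
theorem bijective_ofFinEmbEquiv_symm_univPC {N : ℕ} (hN : Fintype.card I = N) :
    Bijective (Set.powersetCard.ofFinEmbEquiv.symm (univPC hN)) := by
  refine ⟨(Set.powersetCard.ofFinEmbEquiv.symm (univPC hN)).injective, fun x => ?_⟩
  have : x ∈ Set.range (Set.powersetCard.ofFinEmbEquiv.symm (univPC hN)) :=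
    (Set.powersetCard.mem_range_ofFinEmbEquiv_symm_iff_mem _ x).mpr (by
      show x ∈ (univ : Finset I)
      exact mem_univ x)
  exact this

variable (b : Basis I R M)

/-- **The top form of the wedge of the basis along a bijective enumeration is a sign.**  With `s` the
increasing enumeration of `I` and `π := s⁻¹ ∘ idx`, `b ∘ idx = (b ∘ s) ∘ π`, so the wedge is
`sign π • (b_{s 0} ∧ ⋯ ∧ b_{s (N−1)})` (`AlternatingMap.map_perm`) and its top form is `sign π • 1`. -/
theorem ιMultiDual_univ_ιMulti_of_bijective {N : ℕ} (hN : Fintype.card I = N) (idx : Fin N → I)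
    (hidx : Bijective idx) :
    ∃ ε : ℤˣ, exteriorPower.ιMultiDual R N b (univPC hN) (exteriorPower.ιMulti R N (b ∘ idx)) = ((ε : ℤ) : R) := by
  classical
  set s := Set.powersetCard.ofFinEmbEquiv.symm (univPC hN) with hs
  let se : Fin N ≃ I := Equiv.ofBijective s (bijective_ofFinEmbEquiv_symm_univPC hN)
  let ie : Fin N ≃ I := Equiv.ofBijective idx hidx
  let π : Equiv.Perm (Fin N) := ie.trans se.symm
  have hπ : (b ∘ ⇑s) ∘ π = b ∘ idx := by
    funext i
    simp only [Function.comp_apply, π, Equiv.trans_apply, ie, Equiv.ofBijective_apply]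
    congr 1
    exact se.apply_symm_apply (idx i)
  refine ⟨Equiv.Perm.sign π, ?_⟩
  rw [← hπ, AlternatingMap.map_perm, Units.smul_def, map_zsmul]
  have hdiag := exteriorPower.ιMultiDual_apply_diag R N b (univPC hN)
  rw [exteriorPower.ιMulti_family, ← hs] at hdiag
  rw [hdiag, zsmul_one]

/-- In characteristic zero the top form of a bijective wedge of the basis is non-zero. -/
theorem ιMultiDual_univ_ιMulti_of_bijective_ne_zero [CharZero R] {N : ℕ} (hN : Fintype.card I = N)
    (idx : Fin N → I) (hidx : Bijective idx) :
    exteriorPower.ιMultiDual R N b (univPC hN) (exteriorPower.ιMulti R N (b ∘ idx)) ≠ 0 := by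
  obtain ⟨ε, hε⟩ := ιMultiDual_univ_ιMulti_of_bijective b hN idx hidx
  rw [hε]
  exact Int.cast_ne_zero.mpr (Units.ne_zero ε)

/-- The graded product: `x ∈ ⋀^n`, `y ∈ ⋀^n`, `Λ ∈ ⋀^k` give `x * y * Λ ∈ ⋀^{n+n+k}`. -/
theorem mul_mul_mem {n k : ℕ} (x y : ⋀[R]^n M) {Λ : ExteriorAlgebra R M} (hΛ : Λ ∈ ⋀[R]^k M) :
    (x : ExteriorAlgebra R M) * y * Λ ∈ ⋀[R]^(n + n + k) M := by
  rw [exteriorPower, pow_add, pow_add]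
  exact Submodule.mul_mem_mul (Submodule.mul_mem_mul x.2 y.2) hΛ

/-- **The form `(x, y) ↦ ∫ x ∧ y ∧ Λ`** on `⋀^n M`, for a fixed `Λ ∈ ⋀^k M` and `|I| = n + n + k`: the top form
(the coordinate of `b_{univ}`) of the graded product. -/
noncomputable def wedgeForm (n k : ℕ) (Λ : ExteriorAlgebra R M) (hΛ : Λ ∈ ⋀[R]^k M)
    (hN : Fintype.card I = n + n + k) : LinearMap.BilinForm R (⋀[R]^n M) :=
  LinearMap.mk₂ R (fun x y => exteriorPower.ιMultiDual R (n + n + k) b (univPC hN) ⟨x * y * Λ, mul_mul_mem x y hΛ⟩)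
    (fun x₁ x₂ y => by
      rw [← map_add]
      congr 1
      ext
      simp only [Submodule.coe_add, add_mul])
    (fun c x y => by
      rw [← map_smul]
      congr 1
      ext
      simp only [Submodule.coe_smul, smul_mul_assoc])
    (fun x y₁ y₂ => by
      rw [← map_add]
      congr 1
      ext
      simp only [Submodule.coe_add, mul_add, add_mul])
    (fun c x y => by
      rw [← map_smul]
      congr 1
      ext
      simp only [Submodule.coe_smul, mul_smul_comm, smul_mul_assoc])

/-- `wedgeForm` unfolded. -/
theorem wedgeForm_apply (n k : ℕ) (Λ : ExteriorAlgebra R M) (hΛ : Λ ∈ ⋀[R]^k M)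
    (hN : Fintype.card I = n + n + k) (x y : ⋀[R]^n M) :
    wedgeForm b n k Λ hΛ hN x y =
      exteriorPower.ιMultiDual R (n + n + k) b (univPC hN) ⟨x * y * Λ, mul_mul_mem x y hΛ⟩ := rfl

omit [Fintype I] in
/-- The top form of an element of `⋀^N M` given as `c • (v₁ ∧ ⋯ ∧ v_N)` in the algebra. -/
theorem ιMultiDual_mk_smul_ιMulti {N : ℕ} (s : Set.powersetCard I N) (c : R) (v : Fin N → M)
    {z : ExteriorAlgebra R M} (hz : z ∈ ⋀[R]^N M) (hzv : z = c • ιMulti R N v) :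
    exteriorPower.ιMultiDual R N b s ⟨z, hz⟩ = c * exteriorPower.ιMultiDual R N b s (exteriorPower.ιMulti R N v) := by
  subst hzv
  have h : (⟨c • ιMulti R N v, hz⟩ : ⋀[R]^N M) = c • exteriorPower.ιMulti R N v := Subtype.ext rfl
  rw [h, map_smul, smul_eq_mul]

end Top

end HodgeRepro.Night3.ExtTop
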